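import Summits.Ventures.PercRepro.Night2ExcessLossM2

/-!
# PercRepro — the per-basis bound at general `q`: the loss-free regime and the cell `(q − 1, q − 3)` (night-2, gen 20)

* `one_div_le_chord`: the chord of `1/(m + d)` over `2 ≤ m ≤ h` in closed form — with `b = 1/((2 + d)(h + d))` and
  `a = (h + d + 2)/((2 + d)(h + d))`, `a − b m − 1/(m + d) = (m − 2)(h − m)/((2 + d)(h + d)(m + d)) ≥ 0`;
* `sum_faceLoss_le_max_excessBound`: the face losses of a covering basis are at most `max 0 excessBound` (no sign
  hypothesis), hence **`localShadowHall_of_excessBound_nonpos`**: when `excessBound ≤ 0` NO covering basis loses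
  anything and (LI_G) holds outright — the LOSS-FREE regime;
* **`localShadowHall_qm1_qm3`**: the regime `|E ∖ G| = q − 1`, `kColoops = q − 3` (`ρ = 4`) at EVERY `q ≥ 4`, with
  the explicit chord `a_q(n) = (n + q − 2)/((q + 1)(n + q − 4))`, `b_q(n) = 1/((q + 1)(n + q − 4))` — (LI_G) holds as
  soon as `genSum n 4 2 c′ (E/4) ≥ 1` whenever `E = excessBound q (q−1) 4 (q−3) n a b > 0`; for `n > (q³ + 5q² + 9q +
  12)/(2q + 3)` the bound `E` is `≤ 0` and nothing is lost.  Numerically (proofs/NIGHT-2-g20.md §6) the sum condition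
  holds at every `q` tested (the crude bound of gen 19 failed from `q = 9`).
-/

namespace PercRepro.Shadow

open Finset PerFlat ThmH

/-- **The chord of `1/(m + d)` over `[2, h]`**: `1/(m + d) ≤ (h + d + 2)/((2 + d)(h + d)) − m/((2 + d)(h + d))` for
`2 ≤ m ≤ h` and `d ≥ 1` (all naturals). -/
theorem one_div_le_chord {d h m : ℕ} (hd : 1 ≤ d) (hm2 : 2 ≤ m) (hmh : m ≤ h) :
    1 / ((m : ℚ) + (d : ℚ)) ≤
      ((h : ℚ) + (d : ℚ) + 2) / ((2 + (d : ℚ)) * ((h : ℚ) + (d : ℚ))) -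
        (1 / ((2 + (d : ℚ)) * ((h : ℚ) + (d : ℚ)))) * (m : ℚ) := by
  have hd' : (1 : ℚ) ≤ (d : ℚ) := by exact_mod_cast hd
  have hm2' : (2 : ℚ) ≤ (m : ℚ) := by exact_mod_cast hm2
  have hmh' : (m : ℚ) ≤ (h : ℚ) := by exact_mod_cast hmh
  have h1 : (m : ℚ) + (d : ℚ) ≠ 0 := by linarith
  have h2 : 2 + (d : ℚ) ≠ 0 := by linarith
  have h3 : (h : ℚ) + (d : ℚ) ≠ 0 := by linarith
  have key : ((h : ℚ) + (d : ℚ) + 2) / ((2 + (d : ℚ)) * ((h : ℚ) + (d : ℚ))) -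
      (1 / ((2 + (d : ℚ)) * ((h : ℚ) + (d : ℚ)))) * (m : ℚ) - 1 / ((m : ℚ) + (d : ℚ)) =
      ((m : ℚ) - 2) * ((h : ℚ) - (m : ℚ)) / ((2 + (d : ℚ)) * ((h : ℚ) + (d : ℚ)) * ((m : ℚ) + (d : ℚ))) := by
    field_simp
    ring
  have hnn : 0 ≤ ((m : ℚ) - 2) * ((h : ℚ) - (m : ℚ)) /
      ((2 + (d : ℚ)) * ((h : ℚ) + (d : ℚ)) * ((m : ℚ) + (d : ℚ))) := by
    apply div_nonneg (mul_nonneg (by linarith) (by linarith))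
    have : (0 : ℚ) < (2 + (d : ℚ)) * ((h : ℚ) + (d : ℚ)) * ((m : ℚ) + (d : ℚ)) := by
      apply mul_pos (mul_pos (by linarith) (by linarith)) (by linarith)
    exact this.le
  linarith [key, hnn]

variable {α : Type*} [DecidableEq α] {M : Matroid α} [M.Finite]

open scoped Classical in
/-- The face losses of a covering basis are at most `max 0 excessBound` (`sum_faceLoss_le_excessBound` without the
sign hypothesis). -/
theorem sum_faceLoss_le_max_excessBound {q d ρ : ℕ} {G : Finset α} (hG : G ∈ flatsQ M (q + 1))
    (hd : (gr M \ G).card = d) (hdq : d ≤ q) (hk : kColoops M G + ρ = q + 1) (hkd : kColoops M G + 1 ≤ d)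
    (hs : ∀ e ∈ gr M, ∀ f ∈ gr M, e ≠ f → rkN M {e, f} = 2) (hl : ∀ e ∈ gr M, M.Indep {e})
    {a b : ℚ} (hb : 0 ≤ b)
    (hchord : ∀ m : ℕ, 2 ≤ m → m ≤ (G \ coloops M G).card - ρ + 1 →
      1 / ((m : ℚ) + (d : ℚ)) ≤ a - b * (m : ℚ))
    {Q : Finset α} (hQ : Q ∈ shadowAt M (q + 2) q (Uq M (q + 2) q) G) (hQc : (Q \ coloops M G).card = ρ) :
    ∑ w ∈ Q \ coloops M G, faceLoss M q G Q w ≤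
      max 0 (excessBound q d ρ (kColoops M G) (G \ coloops M G).card a b) := by
  have hd' : (gr M \ G).card ≤ q := by omega
  have hd1 : 1 ≤ d := by omega
  have hQG : Q ⊆ G := subset_G_of_mem_shadowAt hQ
  have hcap : 0 ≤ capS M q G Q := capS_nonneg' hG hd' Q
  have hcapDG : capDG q d (kColoops M G) ≤ capS M q G Q := by
    unfold capDG; exact capS_ge_one_sub_kColoops (q := q) hd hQG
  set n := (G \ coloops M G).card with hn
  have hface : ∀ w ∈ Q \ coloops M G,
      1 / (((G \ clF M (Q.erase w)).card : ℚ) + (d : ℚ)) ≤ a - b * ((G \ clF M (Q.erase w)).card : ℚ) := by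
    intro w hw
    apply hchord
    · exact two_le_card_face hk hQ hQc hw
    · have h1 := card_face_le hG hQ (w := w)
      have h2 := card_sdiff_add_eq_of_mem_shadowAt hQ hQc
      omega
  have hsumfaces := two_mul_card_le_sum_faces hG hk hs hl hQ hQc
  have hL1 : L1 M q G Q ≤ phiQ q * ((ρ : ℚ) * a - b * (2 * (n : ℚ) - (ρ : ℚ))) := by
    calc L1 M q G Q ≤ phiQ q * ∑ w ∈ Q \ coloops M G, 1 / (((G \ clF M (Q.erase w)).card : ℚ) + (d : ℚ)) :=
          L1_le_sum_faces hG hd hd1 hdq hQ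
      _ ≤ phiQ q * ∑ w ∈ Q \ coloops M G, (a - b * ((G \ clF M (Q.erase w)).card : ℚ)) :=
          mul_le_mul_of_nonneg_left (Finset.sum_le_sum hface) (phiQ_pos q).le
      _ = phiQ q * ((ρ : ℚ) * a - b * ∑ w ∈ Q \ coloops M G, ((G \ clF M (Q.erase w)).card : ℚ)) := by
          rw [Finset.sum_sub_distrib, Finset.sum_const, hQc, nsmul_eq_mul, Finset.mul_sum]
      _ ≤ phiQ q * ((ρ : ℚ) * a - b * (2 * (n : ℚ) - (ρ : ℚ))) := by
          apply mul_le_mul_of_nonneg_left _ (phiQ_pos q).le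
          have hcast : (2 * (n : ℚ) - (ρ : ℚ)) ≤ ∑ w ∈ Q \ coloops M G, ((G \ clF M (Q.erase w)).card : ℚ) := by
            have h := hsumfaces
            rw [← hn] at h
            have h' : ((2 * n : ℕ) : ℚ) ≤ ((ρ + ∑ w ∈ Q \ coloops M G, (G \ clF M (Q.erase w)).card : ℕ) : ℚ) := by
              exact_mod_cast h
            push_cast at h'
            linarith
          nlinarith [hcast, hb]
  calc ∑ w ∈ Q \ coloops M G, faceLoss M q G Q w ≤ L1 M q G Q * (1 - fS M q G Q) :=
        sum_faceLoss_le_L1_mul hG hd' Q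
    _ ≤ max 0 (L1 M q G Q - capS M q G Q) := L1_mul_one_sub_fS_le hcap
    _ ≤ max 0 (excessBound q d ρ (kColoops M G) n a b) := by
        apply max_le (le_max_left _ _)
        apply le_max_of_le_right
        unfold excessBound
        linarith

open scoped Classical in
/-- **THE LOSS-FREE REGIME**: when `excessBound ≤ 0` (partial-spread regime with `m₁`), no covering basis loses
anything, every loss vanishes, and (LI_G) holds. -/
theorem localShadowHall_of_excessBound_nonpos {q d ρ m₁ : ℕ} {G : Finset α} (hG : G ∈ flatsQ M (q + 1))
    (hd : (gr M \ G).card = d) (hdq : d ≤ q) (hk : kColoops M G + ρ = q + 1)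
    (hkd : kColoops M G + 1 ≤ d) (hs : ∀ e ∈ gr M, ∀ f ∈ gr M, e ≠ f → rkN M {e, f} = 2)
    (hl : ∀ e ∈ gr M, M.Indep {e}) (hc : 0 ≤ cPrimeDGP q d ρ (kColoops M G) m₁)
    (hm₁ : ∀ B ∈ thinMembers M q G, ρ ≤ (B \ coloops M G).card → m₁ ≤ (G \ clF M B).card)
    {a b : ℚ} (hb : 0 ≤ b)
    (hchord : ∀ m : ℕ, 2 ≤ m → m ≤ (G.card - kColoops M G) - ρ + 1 →
      1 / ((m : ℚ) + (d : ℚ)) ≤ a - b * (m : ℚ))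
    (hE : excessBound q d ρ (kColoops M G) (G.card - kColoops M G) a b ≤ 0) : LocalShadowHall M q G := by
  have hd' : (gr M \ G).card ≤ q := by omega
  have hKG : coloops M G ⊆ G := fun y hy => (mem_coloops.1 hy).1
  have hnK : (G \ coloops M G).card = G.card - kColoops M G := by
    rw [Finset.card_sdiff_of_subset hKG, kColoops_eq_card_coloops]
  have hchord' : ∀ m : ℕ, 2 ≤ m → m ≤ (G \ coloops M G).card - ρ + 1 →
      1 / ((m : ℚ) + (d : ℚ)) ≤ a - b * (m : ℚ) := by
    intro m hm hm'; rw [hnK] at hm'; exact hchord m hm hm'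
  have hE' : excessBound q d ρ (kColoops M G) (G \ coloops M G).card a b ≤ 0 := by rw [hnK]; exact hE
  apply localShadowHall_of_lossFair hG hd'
  intro B hB z hz
  suffices hl0 : loss M q G B z = 0 by
    rw [hl0]
    exact mul_nonneg (rhoL_nonneg hG hd' B z) (lossIncome_nonneg hG hd' B z)
  by_cases h2 : (B \ coloops M G).card + 1 = ρ
  · -- a covering basis: its face losses sum to ≤ max 0 E = 0
    have hQ := insert_mem_shadowAt_thin hG hB hz
    have hB' : B ∈ membersIn M (Uq M (q + 2) q) G := (mem_thinMembers.1 hB).1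
    have hBU : B ∈ Uq M (q + 2) q := (mem_membersIn.1 hB').1
    have hzB : z ∉ B := notMem_of_notMem_clF hBU (Finset.mem_sdiff.1 hz).2
    have hK := coloops_subset_of_mem_thinMembers hG hd' hB
    have hzK : z ∉ coloops M G := fun h => hzB (hK h)
    have hQc : (insert z B \ coloops M G).card = ρ := by
      rw [card_insert_sdiff_coloops_thin hG hd' hB hz]; exact h2
    have hsum := sum_faceLoss_le_max_excessBound hG hd hdq hk hkd hs hl hb hchord' hQ hQc
    rw [max_eq_left hE'] at hsum
    have hz' : z ∈ insert z B \ coloops M G := Finset.mem_sdiff.2 ⟨Finset.mem_insert_self _ _, hzK⟩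
    have hterm : faceLoss M q G (insert z B) z ≤ 0 := by
      have hle := Finset.single_le_sum (fun w _ => faceLoss_nonneg hG hd' (insert z B) w) hz'
      linarith
    have hge := faceLoss_nonneg hG hd' (insert z B) z
    have hzero : faceLoss M q G (insert z B) z = 0 := le_antisymm hterm hge
    unfold faceLoss at hzero
    rw [Finset.erase_insert hzB, if_pos ⟨hB, hz⟩] at hzero
    exact hzero
  · -- not a basis member: no loss in the partial-spread regime
    have hge := card_sdiff_coloops_thin_ge hG hd' hk hB
    exact loss_eq_zero_of_card_ge_dgenP hG hd hdq hk hc hs hl hm₁ hB (by omega) hz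

/-! ## The regime `(q − 1, q − 3)` at every `q ≥ 4` -/

/-- The chord intercept of the cell `(q − 1, q − 3)`: `a_q(n) = (n + q − 2)/((q + 1)(n + q − 4))`. -/
noncomputable def aQ (q n : ℕ) : ℚ := ((n : ℚ) + (q : ℚ) - 2) / (((q : ℚ) + 1) * ((n : ℚ) + (q : ℚ) - 4))

/-- The chord slope of the cell `(q − 1, q − 3)`: `b_q(n) = 1/((q + 1)(n + q − 4))`. -/
noncomputable def bQ (q n : ℕ) : ℚ := 1 / (((q : ℚ) + 1) * ((n : ℚ) + (q : ℚ) - 4))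

omit [DecidableEq α] [M.Finite] in
/-- `c′ = (4q + 6)/(q (q + 1)²) > 0` in the cell `(q − 1, q − 3)` with `m₁ = 2`. -/
theorem cPrimeDGP_qm1_qm3_pos {q : ℕ} (hq : 4 ≤ q) : 0 < cPrimeDGP q (q - 1) 4 (q - 3) 2 := by
  have hq' : (4 : ℚ) ≤ (q : ℚ) := by exact_mod_cast hq
  have h1 : (q : ℚ) ≠ 0 := by linarith
  have h2 : (q : ℚ) + 1 ≠ 0 := by linarith
  have key : cPrimeDGP q (q - 1) 4 (q - 3) 2 = (4 * (q : ℚ) + 6) / ((q : ℚ) * ((q : ℚ) + 1) ^ 2) := by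
    unfold cPrimeDGP capDG reqDGP phiQ
    rw [Nat.cast_sub (by omega : 1 ≤ q), Nat.cast_sub (by omega : 3 ≤ q)]
    push_cast
    have h3 : (1 : ℚ) + ((q : ℚ) - 1) ≠ 0 := by linarith
    have h4 : (2 : ℚ) + ((q : ℚ) - 1) ≠ 0 := by linarith
    field_simp
    ring
  rw [key]
  have h5 : (0 : ℚ) < (q : ℚ) := by linarith
  positivity

omit [DecidableEq α] [M.Finite] in
/-- The chord `a_q(n) − b_q(n) m` majorises `1/(m + (q − 1))` on `2 ≤ m ≤ n − 3` (`q ≥ 4`, `n ≥ 5`). -/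
theorem chord_qm1_qm3 {q n : ℕ} (hq : 4 ≤ q) (hn : 5 ≤ n) :
    ∀ m : ℕ, 2 ≤ m → m ≤ n - 4 + 1 → 1 / ((m : ℚ) + ((q - 1 : ℕ) : ℚ)) ≤ aQ q n - bQ q n * (m : ℚ) := by
  intro m hm2 hmh
  have h := one_div_le_chord (d := q - 1) (h := n - 3) (m := m) (by omega) hm2 (by omega)
  have e1 : ((n - 3 : ℕ) : ℚ) = (n : ℚ) - 3 := by rw [Nat.cast_sub (by omega)]; push_cast; ring
  have e2 : ((q - 1 : ℕ) : ℚ) = (q : ℚ) - 1 := by rw [Nat.cast_sub (by omega)]; push_cast; ring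
  rw [e1, e2] at h
  rw [e2]
  unfold aQ bQ
  have e3 : ((n : ℚ) - 3 + ((q : ℚ) - 1) + 2) = (n : ℚ) + (q : ℚ) - 2 := by ring
  have e4 : (2 + ((q : ℚ) - 1)) * ((n : ℚ) - 3 + ((q : ℚ) - 1)) = ((q : ℚ) + 1) * ((n : ℚ) + (q : ℚ) - 4) := by ring
  rw [e3, e4] at h
  exact h

open scoped Classical in
/-- **THE REGIME `(q − 1, q − 3)` AT EVERY `q ≥ 4`**: (LI_G) at a rank-`(q+1)` flat with `|E ∖ G| = q − 1` and
`q − 3` coloops of `M|G` of a simple loopless matroid, provided the target sum with the per-basis bound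
`E = excessBound q (q−1) 4 (q−3) n (aQ q n) (bQ q n)` is `≥ 1` whenever `E > 0` (for `E ≤ 0` nothing is lost). -/
theorem localShadowHall_qm1_qm3 {q : ℕ} (hq : 4 ≤ q) {G : Finset α} (hG : G ∈ flatsQ M (q + 1))
    (hd : (gr M \ G).card = q - 1) (hk : kColoops M G = q - 3)
    (hs : ∀ e ∈ gr M, ∀ f ∈ gr M, e ≠ f → rkN M {e, f} = 2) (hl : ∀ e ∈ gr M, M.Indep {e})
    (hsum : 0 < excessBound q (q - 1) 4 (q - 3) (G.card - kColoops M G) (aQ q (G.card - kColoops M G))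
        (bQ q (G.card - kColoops M G)) →
      1 ≤ DGenP.genSum (G.card - kColoops M G) 4 (q - (q - 1) + 1) (cPrimeDGP q (q - 1) 4 (q - 3) 2)
        (excessBound q (q - 1) 4 (q - 3) (G.card - kColoops M G) (aQ q (G.card - kColoops M G))
          (bQ q (G.card - kColoops M G)) / ((4 : ℕ) : ℚ))) : LocalShadowHall M q G := by
  have hk' : kColoops M G + 4 = q + 1 := by omega
  have hkd : kColoops M G + 1 ≤ q - 1 := by omega
  have hd' : (gr M \ G).card ≤ q := by omega
  have hm₁ : ∀ B ∈ thinMembers M q G, 4 ≤ (B \ coloops M G).card → 2 ≤ (G \ clF M B).card :=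
    fun B hB _ => two_le_card_sdiff_of_not_lay0 hG hd' (mem_thinMembers.1 hB).1 (mem_thinMembers.1 hB).2
  have hc : 0 ≤ cPrimeDGP q (q - 1) 4 (kColoops M G) 2 := by rw [hk]; exact (cPrimeDGP_qm1_qm3_pos hq).le
  set n := G.card - kColoops M G with hn
  -- below n = 6 there is no thin member at all
  by_cases hn6 : 6 ≤ n
  · have hb : 0 ≤ bQ q n := by
      unfold bQ
      have : (0 : ℚ) < ((q : ℚ) + 1) * ((n : ℚ) + (q : ℚ) - 4) := by
        have h1 : (4 : ℚ) ≤ (q : ℚ) := by exact_mod_cast hq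
        have h2 : (6 : ℚ) ≤ (n : ℚ) := by exact_mod_cast hn6
        nlinarith
      positivity
    have hchord : ∀ m : ℕ, 2 ≤ m → m ≤ (G.card - kColoops M G) - 4 + 1 →
        1 / ((m : ℚ) + ((q - 1 : ℕ) : ℚ)) ≤ aQ q n - bQ q n * (m : ℚ) := by
      intro m hm hm'
      exact chord_qm1_qm3 hq (by omega) m hm hm'
    by_cases hE : 0 < excessBound q (q - 1) 4 (q - 3) n (aQ q n) (bQ q n)
    · have hE' : 0 < excessBound q (q - 1) 4 (kColoops M G) n (aQ q n) (bQ q n) := by rw [hk]; exact hE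
      have hsum' := hsum hE
      rw [← hk] at hsum'
      exact localShadowHall_excess_of_sum (d := q - 1) (ρ := 4) (m₁ := 2) hG hd (by omega) hk' (by norm_num)
        hkd hs hl hc hm₁ hb hchord hE' hsum'
    · push Not at hE
      have hE' : excessBound q (q - 1) 4 (kColoops M G) n (aQ q n) (bQ q n) ≤ 0 := by rw [hk]; exact hE
      exact localShadowHall_of_excessBound_nonpos (d := q - 1) (ρ := 4) (m₁ := 2) hG hd (by omega) hk' hkd
        hs hl hc hm₁ hb hchord hE'
  · push Not at hn6
    -- below n = 6 there is no thin member at all: the per-loss condition is vacuous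
    exact localShadowHall_of_lossFair hG hd'
      (fun B hB => absurd (thin_card_bound (ρ := 4) hG hd (by omega) hk' hB) (by omega))

end PercRepro.Shadow
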